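import Literature.AlgebraicGeometry.Frobenioids.UnitsFunctor
import Literature.AlgebraicGeometry.Frobenioids.PullbackLinear
import Literature.AlgebraicGeometry.Frobenioids.ElementaryIsomorphisms
import HarnessLib

/-!
# Frobenioids I, Proposition 2.2 (ii), (iii): the functor `O^▷(−)` on `D*` exists uniquely;
# `Div` is natural — proofs

Mochizuki, *The geometry of Frobenioids I: the general theory*, Kyushu J. Math. **62** (2008)
293–400, §2, Proposition 2.2 (ii), (iii) and its proof, kurims text pp. 45–46
[cite: MochizukiFrdI2008, Prop. 2.2 p.45]. PROOF-ONLY companion of `UnitsFunctor.lean` (statements,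
seat abc-iut-L1-t2): discharges `PreFrobenioid.UnitsFunctorExistsUnique F` (Prop. 2.2 (ii)) as
`unitsFunctorExistsUnique_holds` and `PreFrobenioid.UnitsFunctorData.DivNatural O` (Prop. 2.2 (iii),
"functorial" on all of `D*`) as `UnitsFunctorData.divNatural_holds`, under the hypothesis
`hF : IsFrobenioid F` the statements presuppose (p. 44). No new definitions.

Authors: abc-iut-L1-t14 (all proofs; staged 2026-08-25T19:53Z, sha12 a534da545c4d, companion of record
per L1-lead RULING W2-6). Filed byte-identical apart from this paragraph by abc-iut-w5-d162 as
filer-of-record (plan/L1/DISCHARGE-L1.md §0 row W6; L1-lead R81 (4) pattern), after re-checking the file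
against the current tree (its former blocker, the import `PullbackLinear`, has landed).

Proof (p. 46, ll. 4–35, organised around "roofs"). For isotropic `A, B` and `f : A_D → B_D`, a
*roof* for `f` is an isotropic `X` with a co-angular pre-step `γ : X → A` and a linear `ψ : X → B`
with `Base(ψ) = f ∘ Base(γ)`; roofs exist by Def. 1.3 (i)(c) [a pull-back morphism over `f` — the
text's "isomorphism `A_D ⥲ C_D` followed by the projection of a pull-back morphism"], (i)(b) and
(vii). Along a roof, `β ∈ O^▷(B)` goes to the unique `α ∈ O^▷(A)` with `O^▷(γ)(α) = O^▷(ψ)(β)`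
(`O^▷(ψ)` the injection of Prop. 1.11 (iv), `O^▷(γ)` the bijection of Def. 1.3 (iii)(c)). The
text's "independent of the choice of `γ_A, γ_B`" (ll. 20–34: dominate two choices by pre-steps from
a common object, Def. 1.3 (i)(b); the bijections of (iii)(c) depend only on `Base`) is
`unitsRoof_transport_independent`; functoriality and uniqueness follow from it. Composition is
diagrammatic (`φ ≫ β = α ≫ φ` is the text's `β ∘ φ = φ ∘ α`).
-/

namespace Literature.AlgebraicGeometry.Frobenioids

open CategoryTheory Opposite

universe w v v' u u'

namespace PreFrobenioid

variable {D : Type u} [Category.{v} D] {Φ : Dᵒᵖ ⥤ CommMonCat.{w}}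
  {C : Type u'} [Category.{v'} C] {F : C ⥤ ElemFrobenioid Φ}

/-! ### Preliminaries: arrows out of isotropic objects -/

/-- In a Frobenioid every arrow with isotropic domain is co-angular (Def. 1.3 (vii)(b): its
codomain, and the codomain of any arrow out of the domain, is isotropic; then Prop. 1.4 (i)).
[cite: MochizukiFrdI2008, Prop. 1.4(i) p.25] -/
theorem isCoAngular_of_isIsotropic_dom (hF : IsFrobenioid F) {X Y : C} (hX : IsIsotropic F X)
    (φ : X ⟶ Y) : IsCoAngular F φ :=
  isCoAngular_of_isIsotropic_codomains F φ fun _ g => hF.vii_b g hX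

/-! ### `O^▷` along a co-angular pre-step: the inverse of the bijection of Def. 1.3 (iii)(c) -/

/-- For a co-angular pre-step `φ : X → Y` and `β ∈ O^▷(Y)` there is `α ∈ O^▷(X)` with
`β ∘ φ = φ ∘ α` (the inverse of the bijection `O^▷(X) ⥲ O^▷(Y)` of Def. 1.3 (iii)(c)).
[cite: MochizukiFrdI2008, Def. 1.3(iii) p.24] -/
theorem exists_endSubmonoid_pull_of_isCoAngularPreStep (hF : IsFrobenioid F) {X Y : C}
    {φ : X ⟶ Y} (hφ : IsCoAngularPreStep F φ) (β : endSubmonoid F Y) :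
    ∃ α : endSubmonoid F X, φ ≫ (β.1 : Y ⟶ Y) = (α.1 : X ⟶ X) ≫ φ := by
  obtain ⟨e, he⟩ := hF.iii_c φ hφ
  refine ⟨e.symm β, ?_⟩
  have h := he (e.symm β)
  rw [MulEquiv.apply_symm_apply] at h
  exact h

/-- The `α ∈ O^▷(X)` with `β ∘ φ = φ ∘ α` along a co-angular pre-step `φ : X → Y` depends only on
`Base(φ)` ("this bijection depends only … on `Base(φ)`", Def. 1.3 (iii)(c); `φ` is an
epimorphism, so `β` is the image of `α` under the bijection). [cite: MochizukiFrdI2008, Def. 1.3(iii) p.24] -/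
theorem endSubmonoid_pull_eq_of_base_eq_preStep (hF : IsFrobenioid F) {X Y : C} {φ φ' : X ⟶ Y}
    (hφ : IsCoAngularPreStep F φ) (hφ' : IsCoAngularPreStep F φ') (hb : Base F φ = Base F φ')
    {β : endSubmonoid F Y} {α α' : endSubmonoid F X}
    (h : φ ≫ (β.1 : Y ⟶ Y) = (α.1 : X ⟶ X) ≫ φ)
    (h' : φ' ≫ (β.1 : Y ⟶ Y) = (α'.1 : X ⟶ X) ≫ φ') : α = α' := by
  have hC := hF.isPreFrobenioid.isTotallyEpimorphic
  obtain ⟨e, he⟩ := hF.iii_c φ hφ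
  obtain ⟨e', he'⟩ := hF.iii_c φ' hφ'
  haveI := hC.epi φ
  haveI := hC.epi φ'
  have h1 : e α = β := Subtype.ext ((cancel_epi φ).mp ((he α).trans h.symm))
  have h2 : e' α' = β := Subtype.ext ((cancel_epi φ').mp ((he' α').trans h'.symm))
  have h3 : e α' = e' α' := hF.iii_c_base φ φ' hφ hφ' hb α' (e α') (e' α') (he α') (he' α')
  apply e.injective
  rw [h1, h3, h2]

/-! ### `O^▷` along a co-angular linear morphism with isotropic domain depends only on `Base` -/

/-- For linear `ψ, ψ' : E → B` with `E` isotropic and `Base(ψ) = Base(ψ')`, the elements of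
`O^▷(E)` matched to a given `β ∈ O^▷(B)` by the injections of Prop. 1.11 (iv) coincide: factor
`ψ = q ∘ s` (pre-step `s`, pull-back morphism `q`, Prop. 1.7 (iii)), lift `ψ'` along `q` to a
pre-step `s'` with `Base(s') = Base(s)` (Def. 1.2 (ii)), and use that the bijections of
Def. 1.3 (iii)(c) for the co-angular pre-steps `s, s'` depend only on `Base`.
[cite: MochizukiFrdI2008, Prop. 2.2(ii) p.46] -/
theorem endSubmonoid_pull_eq_of_base_eq_linear (hF : IsFrobenioid F) {E B : C}
    (hE : IsIsotropic F E) {ψ ψ' : E ⟶ B} (hψ : IsLinear F ψ) (hψ' : IsLinear F ψ')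
    (hb : Base F ψ = Base F ψ') {β : endSubmonoid F B} {ζ ζ' : endSubmonoid F E}
    (h : ψ ≫ (β.1 : B ⟶ B) = (ζ.1 : E ⟶ E) ≫ ψ)
    (h' : ψ' ≫ (β.1 : B ⟶ B) = (ζ'.1 : E ⟶ E) ≫ ψ') : ζ = ζ' := by
  -- `ψ = s ≫ q`, `s` a pre-step, `q` a pull-back morphism
  obtain ⟨Y, s, q, hfac, hs, hq⟩ := (isLinear_iff_exists_preStep_pullback F hF ψ).mp hψ
  -- lift `ψ'` along `q` over `Base(s)`
  obtain ⟨s', hs'q, hs'b⟩ := hq.exists_lift ψ' (Base F s) (by rw [← hb, ← hfac, base_comp])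
  have hs'pre : IsPreStep F s' := by
    refine ⟨(isLinear_factors F (show IsLinear F (s' ≫ q) by rw [hs'q]; exact hψ')).2, ?_⟩
    show IsIso (Base F s')
    rw [hs'b]
    exact hs.2
  have hsco : IsCoAngularPreStep F s := ⟨isCoAngular_of_isIsotropic_dom hF hE s, hs⟩
  have hs'co : IsCoAngularPreStep F s' := ⟨isCoAngular_of_isIsotropic_dom hF hE s', hs'pre⟩
  -- `η ∈ O^▷(Y)` matched to `β` along the pull-back morphism `q` (Prop. 1.11 (iii)/(iv))
  obtain ⟨⟨hqco, -⟩, hqlin⟩ := hF.iv_b q hq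
  obtain ⟨η, hη⟩ := exists_endSubmonoid_intertwiner hF hqco hqlin β
  -- transport `η` along `s`, `s'`
  obtain ⟨ζ₁, hζ₁⟩ := exists_endSubmonoid_pull_of_isCoAngularPreStep hF hsco η
  obtain ⟨ζ₁', hζ₁'⟩ := exists_endSubmonoid_pull_of_isCoAngularPreStep hF hs'co η
  have e1 : ζ = ζ₁ := endSubmonoid_intertwiner_unique hF hψ h
    (by rw [← hfac, Category.assoc, hη, ← Category.assoc, hζ₁, Category.assoc])
  have e2 : ζ' = ζ₁' := endSubmonoid_intertwiner_unique hF hψ' h'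
    (by rw [← hs'q, Category.assoc, hη, ← Category.assoc, hζ₁', Category.assoc])
  rw [e1, e2]
  exact endSubmonoid_pull_eq_of_base_eq_preStep hF hsco hs'co hs'b.symm hζ₁ hζ₁'

/-! ### Roofs: existence, transport, uniqueness and independence -/

/-- **Roofs exist** (p. 46, ll. 5–10): for isotropic `A, B` and `f : A_D → B_D` there are an
isotropic `X`, a co-angular pre-step `γ : X → A` and a linear `ψ : X → B` with
`Base(ψ) = f ∘ Base(γ)` — a pull-back morphism `W → B` over `f` (Def. 1.3 (i)(c)), pre-steps
realising `W_D ≅ A_D` (Def. 1.3 (i)(b)), made isotropic by an isotropic hull (Def. 1.3 (vii)).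
[cite: MochizukiFrdI2008, Prop. 2.2(ii) p.46] -/
theorem exists_unitsRoof (hF : IsFrobenioid F) {A B : C} (hA : IsIsotropic F A)
    (hB : IsIsotropic F B) (f : baseObj F A ⟶ baseObj F B) :
    ∃ (X : C) (γ : X ⟶ A) (ψ : X ⟶ B), IsIsotropic F X ∧ IsCoAngularPreStep F γ ∧
      IsLinear F ψ ∧ Base F γ ≫ f = Base F ψ := by
  have hD := hF.isPreFrobenioid.isTotallyEpimorphic_base
  obtain ⟨W, p, i, hp, hpb⟩ := exists_isPullbackMorphism_over hF B f
  have hW : IsIsotropic F W := (isIsotropic_iff_of_isPullbackMorphism hF p hp).mpr hB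
  obtain ⟨X, φ, φ', hφ, hφ', hφb⟩ := hF.i_b W A i
  obtain ⟨X₁, h, hh⟩ := hF.vii_a X
  obtain ⟨φ₁, hφ₁⟩ := (hh.2.2.2 φ hW).exists
  obtain ⟨φ₁', hφ₁'⟩ := (hh.2.2.2 φ' hA).exists
  have hφ₁pre : IsPreStep F φ₁ :=
    (isPreStep_factors F hD (show IsPreStep F (h ≫ φ₁) by rw [hφ₁]; exact hφ)).1
  have hφ₁'pre : IsPreStep F φ₁' :=
    (isPreStep_factors F hD (show IsPreStep F (h ≫ φ₁') by rw [hφ₁']; exact hφ')).1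
  refine ⟨X₁, φ₁', φ₁ ≫ p, hh.2.2.1, ⟨isCoAngular_of_isIsotropic_dom hF hh.2.2.1 φ₁', hφ₁'pre⟩,
    IsLinear.comp F hφ₁pre.1 (hF.iv_b p hp).2, ?_⟩
  haveI : IsIso (Base F h) := hh.2.1.2
  apply (cancel_epi (Base F h)).mp
  rw [← Category.assoc, ← base_comp, hφ₁', base_comp, hpb, ← Category.assoc (Base F h) (Base F φ₁),
    ← base_comp, hφ₁, ← Category.assoc, hφb]

/-- **Transport along a roof**, existence: for a roof `(γ : X → A, ψ : X → B)` and `β ∈ O^▷(B)`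
there are `α ∈ O^▷(A)`, `ξ ∈ O^▷(X)` with `α ∘ γ = γ ∘ ξ` and `β ∘ ψ = ψ ∘ ξ` (`ξ` by
Prop. 1.11 (iv) for `ψ`, `α` by the bijection of Def. 1.3 (iii)(c) for `γ`).
[cite: MochizukiFrdI2008, Prop. 2.2(ii) p.46] -/
theorem exists_unitsRoof_transport (hF : IsFrobenioid F) {X A B : C} (hX : IsIsotropic F X)
    {γ : X ⟶ A} (hγ : IsCoAngularPreStep F γ) {ψ : X ⟶ B} (hψ : IsLinear F ψ)
    (β : endSubmonoid F B) :
    ∃ (α : endSubmonoid F A) (ξ : endSubmonoid F X),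
      γ ≫ (α.1 : A ⟶ A) = (ξ.1 : X ⟶ X) ≫ γ ∧ ψ ≫ (β.1 : B ⟶ B) = (ξ.1 : X ⟶ X) ≫ ψ := by
  obtain ⟨ξ, hξ⟩ :=
    exists_endSubmonoid_intertwiner hF (isCoAngular_of_isIsotropic_dom hF hX ψ) hψ β
  obtain ⟨e, he⟩ := hF.iii_c γ hγ
  exact ⟨e ξ, ξ, he ξ, hξ⟩

/-- **Transport along a roof**, uniqueness: `ξ` is unique by Prop. 1.11 (iv) (for the linear
`ψ`), and then `α` is unique since `γ` is an epimorphism. [cite: MochizukiFrdI2008, Prop. 2.2(ii) p.46] -/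
theorem unitsRoof_transport_unique (hF : IsFrobenioid F) {X A B : C} {γ : X ⟶ A} {ψ : X ⟶ B}
    (hψ : IsLinear F ψ) {β : endSubmonoid F B} {α α' : endSubmonoid F A} {ξ ξ' : endSubmonoid F X}
    (hα : γ ≫ (α.1 : A ⟶ A) = (ξ.1 : X ⟶ X) ≫ γ) (hβ : ψ ≫ (β.1 : B ⟶ B) = (ξ.1 : X ⟶ X) ≫ ψ)
    (hα' : γ ≫ (α'.1 : A ⟶ A) = (ξ'.1 : X ⟶ X) ≫ γ)
    (hβ' : ψ ≫ (β.1 : B ⟶ B) = (ξ'.1 : X ⟶ X) ≫ ψ) : α = α' := by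
  have hξ : ξ = ξ' := endSubmonoid_intertwiner_unique hF hψ hβ hβ'
  subst hξ
  haveI := hF.isPreFrobenioid.isTotallyEpimorphic.epi γ
  exact Subtype.ext ((cancel_epi γ).mp (hα.trans hα'.symm))

/-- **Transport is independent of the roof** (p. 46, ll. 20–34): two roofs `(γ, ψ)`, `(γ', ψ')`
for the same `f` transport `β` to the same `α`. Dominate `X, X'` by pre-steps `ε, ε'` from a
common object realising `Base(γ')⁻¹ ∘ Base(γ)` (Def. 1.3 (i)(b)), pass to its isotropic hull
(Def. 1.3 (vii)); then `γ ∘ ε, γ' ∘ ε'` are co-angular pre-steps with the same `Base`, and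
`ψ ∘ ε, ψ' ∘ ε'` are linear with the same `Base`, so both transports factor through the same
element of `O^▷` of the common isotropic object. [cite: MochizukiFrdI2008, Prop. 2.2(ii) p.46] -/
theorem unitsRoof_transport_independent (hF : IsFrobenioid F) {A B X X' : C}
    (hX : IsIsotropic F X) (hX' : IsIsotropic F X') {γ : X ⟶ A} {ψ : X ⟶ B} {γ' : X' ⟶ A}
    {ψ' : X' ⟶ B} (hγ : IsCoAngularPreStep F γ) (hψ : IsLinear F ψ)
    (hγ' : IsCoAngularPreStep F γ') (hψ' : IsLinear F ψ') (f : baseObj F A ⟶ baseObj F B)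
    (hr : Base F γ ≫ f = Base F ψ) (hr' : Base F γ' ≫ f = Base F ψ') {β : endSubmonoid F B}
    {α α' : endSubmonoid F A} {ξ : endSubmonoid F X} {ξ' : endSubmonoid F X'}
    (hα : γ ≫ (α.1 : A ⟶ A) = (ξ.1 : X ⟶ X) ≫ γ) (hβ : ψ ≫ (β.1 : B ⟶ B) = (ξ.1 : X ⟶ X) ≫ ψ)
    (hα' : γ' ≫ (α'.1 : A ⟶ A) = (ξ'.1 : X' ⟶ X') ≫ γ')
    (hβ' : ψ' ≫ (β.1 : B ⟶ B) = (ξ'.1 : X' ⟶ X') ≫ ψ') : α = α' := by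
  have hD := hF.isPreFrobenioid.isTotallyEpimorphic_base
  haveI : IsIso (Base F γ) := hγ.2.2
  haveI : IsIso (Base F γ') := hγ'.2.2
  let i : baseObj F X ≅ baseObj F X' := asIso (Base F γ) ≪≫ (asIso (Base F γ')).symm
  obtain ⟨E, ε, ε', hε, hε', hεb⟩ := hF.i_b X X' i
  obtain ⟨E₁, h, hh⟩ := hF.vii_a E
  obtain ⟨ε₁, hε₁⟩ := (hh.2.2.2 ε hX).exists
  obtain ⟨ε₁', hε₁'⟩ := (hh.2.2.2 ε' hX').exists
  have hE₁ : IsIsotropic F E₁ := hh.2.2.1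
  have hε₁pre : IsPreStep F ε₁ :=
    (isPreStep_factors F hD (show IsPreStep F (h ≫ ε₁) by rw [hε₁]; exact hε)).1
  have hε₁'pre : IsPreStep F ε₁' :=
    (isPreStep_factors F hD (show IsPreStep F (h ≫ ε₁') by rw [hε₁']; exact hε')).1
  have hε₁co : IsCoAngularPreStep F ε₁ := ⟨isCoAngular_of_isIsotropic_dom hF hE₁ ε₁, hε₁pre⟩
  have hε₁'co : IsCoAngularPreStep F ε₁' := ⟨isCoAngular_of_isIsotropic_dom hF hE₁ ε₁', hε₁'pre⟩
  have hb₁ : Base F ε₁ ≫ i.hom = Base F ε₁' := by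
    haveI : IsIso (Base F h) := hh.2.1.2
    apply (cancel_epi (Base F h)).mp
    rw [← Category.assoc, ← base_comp, hε₁, hεb, ← base_comp, hε₁']
  have hγ₁ : IsCoAngularPreStep F (ε₁ ≫ γ) :=
    ⟨isCoAngular_of_isIsotropic_dom hF hE₁ _, IsPreStep.comp F hε₁pre hγ.2⟩
  have hγ₁' : IsCoAngularPreStep F (ε₁' ≫ γ') :=
    ⟨isCoAngular_of_isIsotropic_dom hF hE₁ _, IsPreStep.comp F hε₁'pre hγ'.2⟩
  have hbγ : Base F (ε₁ ≫ γ) = Base F (ε₁' ≫ γ') := by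
    rw [base_comp, base_comp, ← hb₁, Category.assoc]
    congr 1
    show Base F γ = (asIso (Base F γ) ≪≫ (asIso (Base F γ')).symm).hom ≫ Base F γ'
    rw [Iso.trans_hom, Iso.symm_hom, asIso_hom, asIso_inv, Category.assoc, IsIso.inv_hom_id,
      Category.comp_id]
  have hbψ : Base F (ε₁ ≫ ψ) = Base F (ε₁' ≫ ψ') := by
    rw [base_comp, base_comp, ← hr, ← hr', ← Category.assoc, ← Category.assoc, ← base_comp,
      ← base_comp, hbγ]
  obtain ⟨ζ, hζ⟩ := exists_endSubmonoid_pull_of_isCoAngularPreStep hF hε₁co ξ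
  obtain ⟨ζ', hζ'⟩ := exists_endSubmonoid_pull_of_isCoAngularPreStep hF hε₁'co ξ'
  have H1 : (ε₁ ≫ γ) ≫ (α.1 : A ⟶ A) = (ζ.1 : E₁ ⟶ E₁) ≫ (ε₁ ≫ γ) := by
    rw [Category.assoc, hα, ← Category.assoc, hζ, Category.assoc]
  have H2 : (ε₁ ≫ ψ) ≫ (β.1 : B ⟶ B) = (ζ.1 : E₁ ⟶ E₁) ≫ (ε₁ ≫ ψ) := by
    rw [Category.assoc, hβ, ← Category.assoc, hζ, Category.assoc]
  have H1' : (ε₁' ≫ γ') ≫ (α'.1 : A ⟶ A) = (ζ'.1 : E₁ ⟶ E₁) ≫ (ε₁' ≫ γ') := by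
    rw [Category.assoc, hα', ← Category.assoc, hζ', Category.assoc]
  have H2' : (ε₁' ≫ ψ') ≫ (β.1 : B ⟶ B) = (ζ'.1 : E₁ ⟶ E₁) ≫ (ε₁' ≫ ψ') := by
    rw [Category.assoc, hβ', ← Category.assoc, hζ', Category.assoc]
  have hζζ' : ζ = ζ' :=
    endSubmonoid_pull_eq_of_base_eq_linear hF hE₁ (IsLinear.comp F hε₁pre.1 hψ)
      (IsLinear.comp F hε₁'pre.1 hψ') hbψ H2 H2'
  subst hζζ'
  exact hF.iii_c_base (ε₁ ≫ γ) (ε₁' ≫ γ') hγ₁ hγ₁' hbγ ζ α α' H1 H1'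

/-! ### Proposition 2.2 (ii): existence and uniqueness of `O^▷(−)` on `D*` -/

/-- **Proposition 2.2 (ii)** (discharge of `UnitsFunctorExistsUnique`): for a Frobenioid there
is exactly one contravariant functor `D* → Mon`, `A ↦ O^▷(A)`, whose value on (the projection of)
a linear arrow of `C^istr` is the injection of Prop. 1.11 (iv) [(a); (b) is the special case of
pre-steps, Def. 1.3 (iii)(c)]. Existence: transport along chosen roofs (independent of the
choice, hence functorial); uniqueness: any such functor is computed by any roof.
[cite: MochizukiFrdI2008, Prop. 2.2(ii) p.45] -/
theorem unitsFunctorExistsUnique_holds (hF : IsFrobenioid F) : UnitsFunctorExistsUnique F := by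
  classical
  have hC := hF.isPreFrobenioid.isTotallyEpimorphic
  -- a roof for every arrow of `D*`, and transport along the chosen roofs
  choose X γ ψ hX hγ hψ hr using fun (A B : (isotropicObjects F).FullSubcategory)
    (f : baseObj F A.obj ⟶ baseObj F B.obj) => exists_unitsRoof hF A.property B.property f
  choose res ξ hres hξ using fun (A B : (isotropicObjects F).FullSubcategory)
    (f : baseObj F A.obj ⟶ baseObj F B.obj) (β : endSubmonoid F B.obj) =>
    exists_unitsRoof_transport hF (hX A B f) (hγ A B f) (hψ A B f) β
  -- any roof computes `res`
  have hany : ∀ {A B : (isotropicObjects F).FullSubcategory}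
      (f : baseObj F A.obj ⟶ baseObj F B.obj) {X' : C} (hX' : IsIsotropic F X')
      {γ' : X' ⟶ A.obj} {ψ' : X' ⟶ B.obj} (hγ' : IsCoAngularPreStep F γ') (hψ' : IsLinear F ψ')
      (hr' : Base F γ' ≫ f = Base F ψ') (β : endSubmonoid F B.obj) {α' : endSubmonoid F A.obj}
      {ξ' : endSubmonoid F X'},
      γ' ≫ (α'.1 : A.obj ⟶ A.obj) = (ξ'.1 : X' ⟶ X') ≫ γ' →
      ψ' ≫ (β.1 : B.obj ⟶ B.obj) = (ξ'.1 : X' ⟶ X') ≫ ψ' → res A B f β = α' :=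
    fun {A B} f {X'} hX' {γ'} {ψ'} hγ' hψ' hr' β {α'} {ξ'} hα' hβ' =>
      unitsRoof_transport_independent hF (hX A B f) hX' (hγ A B f) (hψ A B f) hγ' hψ' f
        (hr A B f) hr' (hres A B f β) (hξ A B f β) hα' hβ'
  -- the trivial roof `(𝟙, φ)` of a linear `φ : A → B` computes the injection of Prop. 1.11 (iv)
  have hlin : ∀ {A B : (isotropicObjects F).FullSubcategory} (φ : A.obj ⟶ B.obj),
      IsLinear F φ → ∀ β : endSubmonoid F B.obj,
        φ ≫ (β.1 : B.obj ⟶ B.obj) = ((res A B (Base F φ) β).1 : A.obj ⟶ A.obj) ≫ φ := by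
    intro A B φ hφ β
    obtain ⟨ξ₀, hξ₀⟩ :=
      exists_endSubmonoid_intertwiner hF (isCoAngular_of_isIsotropic_dom hF A.property φ) hφ β
    haveI : IsIso (𝟙 A.obj) := inferInstance
    have hid : IsCoAngularPreStep F (𝟙 A.obj) :=
      ⟨isCoAngular_of_isIso F hC (𝟙 A.obj), isPreStep_of_isIso F (𝟙 A.obj)⟩
    have h1 : res A B (Base F φ) β = ξ₀ :=
      hany (Base F φ) A.property hid hφ (by rw [base_id, Category.id_comp]) β
        (by rw [Category.id_comp, Category.comp_id]) hξ₀
    rw [h1]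
    exact hξ₀
  refine ⟨⟨{ res := fun {A B} f =>
              { toFun := res A B f
                map_one' := ?_
                map_mul' := ?_ }
             res_id := ?_
             res_comp := ?_
             res_base := ?_ }⟩, ⟨fun O O' => ?_⟩⟩
  · -- `res f 1 = 1`
    refine hany f (hX A B f) (hγ A B f) (hψ A B f) (hr A B f) 1 (ξ' := 1) ?_ ?_
    · rw [OneMemClass.coe_one, OneMemClass.coe_one, End.one_def, End.one_def,
        Category.id_comp, Category.comp_id]
    · rw [OneMemClass.coe_one, OneMemClass.coe_one, End.one_def, End.one_def,
        Category.id_comp, Category.comp_id]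
  · -- `res f (β * β') = res f β * res f β'`
    intro β β'
    refine hany f (hX A B f) (hγ A B f) (hψ A B f) (hr A B f) (β * β')
      (ξ' := ξ A B f β * ξ A B f β') ?_ ?_
    · rw [Submonoid.coe_mul, Submonoid.coe_mul, End.mul_def, End.mul_def, ← Category.assoc,
        hres A B f β', Category.assoc, hres A B f β, Category.assoc]
    · rw [Submonoid.coe_mul, Submonoid.coe_mul, End.mul_def, End.mul_def, ← Category.assoc,
        hξ A B f β', Category.assoc, hξ A B f β, Category.assoc]
  · -- `res (𝟙) = id`: the trivial roof `(𝟙, 𝟙)`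
    intro A α
    haveI : IsIso (𝟙 A.obj) := inferInstance
    have hid : IsCoAngularPreStep F (𝟙 A.obj) :=
      ⟨isCoAngular_of_isIso F hC (𝟙 A.obj), isPreStep_of_isIso F (𝟙 A.obj)⟩
    exact hany (𝟙 _) A.property hid (isLinear_of_isIso F (𝟙 A.obj))
      (by rw [base_id, Category.id_comp]) α (ξ' := α)
      (by rw [Category.id_comp, Category.comp_id]) (by rw [Category.id_comp, Category.comp_id])
  · -- `res (f ≫ g) = res f ∘ res g`: roofs `(δ, χ ≫ γ_g)` for `f` and `(δ, χ ≫ ψ_g)` for `f ≫ g`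
    intro A B B' f g c
    haveI : IsIso (Base F (γ B B' g)) := (hγ B B' g).2.2
    -- an auxiliary roof for `f ≫ Base(γ_g)⁻¹ : A_D → (X_g)_D`
    obtain ⟨Y, δ, χ, hY, hδ, hχ, hrY⟩ :=
      exists_unitsRoof hF A.property (hX B B' g) (f ≫ inv (Base F (γ B B' g)))
    have hr₁ : Base F δ ≫ f = Base F (χ ≫ γ B B' g) := by
      rw [base_comp, ← hrY, Category.assoc, Category.assoc, IsIso.inv_hom_id, Category.comp_id]
    have hr₂ : Base F δ ≫ (f ≫ g) = Base F (χ ≫ ψ B B' g) := by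
      rw [base_comp, ← hrY, Category.assoc, Category.assoc, ← hr B B' g,
        IsIso.inv_hom_id_assoc]
    -- `ζ ∈ O^▷(Y)` matched to `ξ_g c` along the linear `χ`
    obtain ⟨ζ, hζ⟩ :=
      exists_endSubmonoid_intertwiner hF (isCoAngular_of_isIsotropic_dom hF hY χ) hχ (ξ B B' g c)
    -- `a ∈ O^▷(A)` matched to `ζ` along the co-angular pre-step `δ`
    obtain ⟨e, he⟩ := hF.iii_c δ hδ
    have H1 : δ ≫ ((e ζ).1 : A.obj ⟶ A.obj) = (ζ.1 : Y ⟶ Y) ≫ δ := he ζ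
    -- roof `(δ, χ ≫ γ_g)` for `f` transports `res g c` to `e ζ`
    have Hf : res A B f (res B B' g c) = e ζ :=
      hany f hY hδ (IsLinear.comp F hχ (hγ B B' g).2.1) hr₁ (res B B' g c) H1
        (by rw [Category.assoc, hres B B' g c, ← Category.assoc, hζ, Category.assoc])
    -- roof `(δ, χ ≫ ψ_g)` for `f ≫ g` transports `c` to `e ζ`
    have Hfg : res A B' (f ≫ g) c = e ζ :=
      hany (f ≫ g) hY hδ (IsLinear.comp F hχ (hψ B B' g)) hr₂ c H1
        (by rw [Category.assoc, hξ B B' g c, ← Category.assoc, hζ, Category.assoc])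
    show res A B' (f ≫ g) c = res A B f (res B B' g c)
    rw [Hf, Hfg]
  · -- (a)/(b): on a linear arrow, `res (Base φ)` is the injection of Prop. 1.11 (iv)
    intro A B φ hφ β
    exact hlin φ hφ β
  · -- uniqueness: any two such data agree, since every `res f` is computed by a roof
    rcases O with ⟨res₁, hid₁, hcomp₁, hbase₁⟩
    rcases O' with ⟨res₂, hid₂, hcomp₂, hbase₂⟩
    have key : ∀ (A B : (isotropicObjects F).FullSubcategory)
        (f : baseObj F A.obj ⟶ baseObj F B.obj) (β : endSubmonoid F B.obj),
        res₁ f β = res₂ f β := by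
      intro A B f β
      let X' : (isotropicObjects F).FullSubcategory := ⟨X A B f, hX A B f⟩
      -- both are computed by the chosen roof of `f`
      have h₁γ := hbase₁ (A := X') (B := A) (γ A B f) (hγ A B f).2.1 (res₁ f β)
      have h₁ψ := hbase₁ (A := X') (B := B) (ψ A B f) (hψ A B f) β
      have h₁c : res₁ (A := X') (B := A) (Base F (γ A B f)) (res₁ f β) =
          res₁ (A := X') (B := B) (Base F (ψ A B f)) β := by
        rw [← hcomp₁, hr A B f]
      have h₂γ := hbase₂ (A := X') (B := A) (γ A B f) (hγ A B f).2.1 (res₂ f β)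
      have h₂ψ := hbase₂ (A := X') (B := B) (ψ A B f) (hψ A B f) β
      have h₂c : res₂ (A := X') (B := A) (Base F (γ A B f)) (res₂ f β) =
          res₂ (A := X') (B := B) (Base F (ψ A B f)) β := by
        rw [← hcomp₂, hr A B f]
      rw [h₁c] at h₁γ
      rw [h₂c] at h₂γ
      exact unitsRoof_transport_unique hF (hψ A B f) h₁γ h₁ψ h₂γ h₂ψ
    have hres : @res₁ = @res₂ := by
      funext A B f
      exact MonoidHom.ext (key A B f)
    subst hres
    rfl

/-! ### Proposition 2.2 (iii): `Div` is natural on all of `D*` -/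

/-- **Proposition 2.2 (iii)**, "functorial" (discharge of `UnitsFunctorData.DivNatural`): for
every arrow `f : A_D → B_D` of `D*` and `β ∈ O^▷(B)`, `Div(O^▷(f)(β)) = f^*(Div(β))`. By a roof
`(γ, ψ)` for `f`, `O^▷(Base γ) ∘ O^▷(f) = O^▷(Base ψ)` with `γ, ψ` linear, for which `Div` is
natural (Remark 1.1.1); conclude by injectivity of `Base(γ)^*` (`Base(γ)` is an isomorphism).
[cite: MochizukiFrdI2008, Prop. 2.2(iii) p.45] -/
theorem UnitsFunctorData.divNatural_holds (hF : IsFrobenioid F) (O : UnitsFunctorData F) :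
    O.DivNatural := by
  intro A B f β
  obtain ⟨X, γ, ψ, hX, hγ, hψ, hr⟩ := exists_unitsRoof hF A.property B.property f
  let X' : (isotropicObjects F).FullSubcategory := ⟨X, hX⟩
  have h1 := O.pull_div_res hF (A := X') (B := A) γ hγ.2.1 (O.res f β)
  have h2 := O.pull_div_res hF (A := X') (B := B) ψ hψ β
  have h3 : O.res (A := X') (B := A) (Base F γ) (O.res f β) =
      O.res (A := X') (B := B) (Base F ψ) β := by
    rw [← O.res_comp, hr]
  rw [h3, h2, ← hr, pull_comp] at h1
  haveI : IsIso (Base F γ) := hγ.2.2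
  exact (pull_injective_of_isIso Φ (Base F γ) h1).symm

end PreFrobenioid

end Literature.AlgebraicGeometry.Frobenioids
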